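import Mathlib
import Summits.QuantumFields.BalabanUV.Beta.UnitLatticeOmegaBudgets
import Summits.QuantumFields.BalabanUV.Beta.UnitLatticePartition

/-!
# `Summit.QuantumFields.BalabanUV.Beta.UnitLatticeOmegaBox` — A3-loc-ω ON A BOX OF `ℤ^ν`: EVERY GEOMETRIC BINDER OF THE
# Ω HAND-OFF DISCHARGED (sup-distance, cosine partition of unity on `M`-cubes, decoration cells of side `M_d ≥ 8M`,
# packing `2^ν`, piece domains READ OFF the cell budgets) — what is left is the row's ONE localised piece bound `hT`,
# the near-local inverses (`hPL`, `hloc`, budget `hL`), the far convention `hfar`, and NUMBERS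

HONEST FRAMING (page 1 of everything in this cell).  Discharging `FlowStep.BetaPertH` would make Bałaban's ultraviolet
stability UNCONDITIONAL — a constructive-QFT result; NOT the continuum limit, NOT the Clay problem.  This module
discharges nothing of `BetaPertH`; [folklore] bookkeeping, kernel-checked (unit `b2b-balaban-beta-d4-p3`, road P3, gen 5;
skeleton v1.12 §7.9).  WHAT IT IS: the road-P3 form «ONE named residual» of rider (ρ3) one level down — on the unit
lattice of a box `[0, qM]^ν ⊆ ℤ^ν` (sites `e : Y → ℤ^ν`, any finite `Y`), for ANY finite piece family `K_ω` with cell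
budgets `cellsOf ω` (the row owner's regrouped pieces `AnalyticWalkSum216RowRegroup.pieceOf`, `DG := id`, are the intended
instance), the fully decorated ω-expansion of `(1 + Σ_ω K_ω)⁻¹` IS volume-free row data and SUMS to `(1 + Σ_ω K_ω)⁻¹` at
`s ≡ 1`, GIVEN ONLY: (i) `hT` — the (T3)-shape bound `Σ_l (Σ_ω e^{(κ₁+κ₂)#cellsOf ω}‖K_ω(k,l)‖)e^{κ⁺·supDist(k,l)} ≤ ρ`;
(ii) row-locality of the pieces in their cells (`hKcells`); (iii) the near-local inverses `L_b` (`hPL`, `hloc`) with ONE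
weighted-row-sum budget `hL` — abstract supplier `UnitLatticeLocalInverse` (accretive Combes–Thomas), instance datum = the
coercivity lower bound (G-B9-15); (iv) the far convention `hfar` (threshold `m₀` cells); (v) the numbers `0 < ν`, `0 < M`,
`8M ≤ M_d`, `κ ≥ 0`, `κ₁ > 0`, `κ₂ ≥ 0`, `κ⁺ > κ + κ₁2^ν/(2M)` and the smallness
`ρ_Ω := C_L·((2·2^ν/(2M/(νπ)))·ρ/(e(κ⁺ − κ′)) + 2^ν·e^{−κ₂m₀}·ρ) < 1` («M large», «m₀ large»: R25∕R1 in our letters).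
Nothing of Bałaban's operators is instantiated ((T3), NODE O.2 untouched): `hT` IS the (T3)-slot.  NOT summit progress.
HONEST DEPENDENCY: continuum YM on T⁴ ⇐ BetaPertH ∧ nine spine estimates (0/9 proved); BetaPertH ⇐
(D1) ∧ (D4) ∧ CAP+tail; G-an2-4 gates asym, D1 and NE2/3/4.

CITATION (locator only; nothing printed is used as a hypothesis).  [II] = T. Bałaban, *Renormalization group approach to
lattice gauge field theories. II. Cluster expansions*, Commun. Math. Phys. **116**, 1–22 (1988) [Balaban1988RG2Cluster],
p. 3 (cubes Δ of σ₀, monomials `s(Δ₁)⋯s(Δ_m)`), p. 5 (1.11) (`e^{mκ₁}`, `δ₁M ≥ κ₁`, the 2⁴); [13] = T. Bałaban, *Propagators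
for lattice gauge theories in a background field*, Commun. Math. Phys. **99**, 389–434 (1985)
[Balaban1985BackgroundPropagators], Thm 3.10 (3.108) p. 416.

CONTENTS (0 sorry).  §1 `cellAt`, `domOf` (piece domains read off the cell budgets), their membership lemmas.  §2
**`rowData_decFamilyΩ_box`** (the hand-off on the box: `UnitLatticeOmegaBudgets.rowData_decFamilyΩ_pieceMaj` with
`d := supDistOn e`, `h := hPart M q e`, `E := EPart M q e`, `cellOf := gridCellOf M_d ∘ e`, `r := 2M`, `D := 2M`, `R := 4M`,
`P := 2^ν`, `N := 2^ν`, Lipschitz modulus `2M/(νπ)` — `UnitLatticePartition` + `UnitLatticeTubeCount.packing_comap` BY NAME).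
§3 **`termSum_decFamilyΩ_box_one`** (at `s ≡ 1` the sum is `(1 + Σ_ω K_ω)⁻¹`: `hPart_sq_sum` gives `Σ_b h_b² = 1` on the
box, `resummation_identity₂`, the row owner's `wrs_Rem₂_le`, `termSum_decFamilyΩ_one` BY NAME).  §4 non-vacuity.
NOT HERE: the torus-periodic twin; any instance on Bałaban's operators.  NOT summit progress.
-/

open scoped BigOperators Matrix
open Finset Matrix Metric Real

namespace Summit.QuantumFields.BalabanUV.Beta.UnitLatticeOmegaBox

open Summit.QuantumFields.BalabanUV.Beta.UnitLatticeWalkInversion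
open Summit.QuantumFields.BalabanUV.Beta.UnitLatticeTubeCount (supDist supDistOn weightHyp_supDistOn gridCellOf
  packing_comap)
open Summit.QuantumFields.BalabanUV.Beta.UnitLatticePartition (hPart EPart hPart_sq_sum hPart_supp abs_hPart_le
  hPart_lipschitz' card_EPart_filter_le diam_EPart_le)
open Summit.QuantumFields.BalabanUV.Beta.UnitLatticeOmegaTerms
open Summit.QuantumFields.BalabanUV.Beta.UnitLatticeOmegaPaths
open Summit.QuantumFields.BalabanUV.Beta.UnitLatticeOmegaRowData
open Summit.QuantumFields.BalabanUV.Beta.UnitLatticeOmegaCells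
open Summit.QuantumFields.BalabanUV.Beta.UnitLatticeOmegaBudgets
open Summit.QuantumFields.BalabanUV.Beta.AnalyticWalkSum216 (termSum)
open Summit.QuantumFields.BalabanUV.Beta.AnalyticWalkSum216RowData (RowData)
open Summit.QuantumFields.BalabanUV.Beta.AnalyticWalkSum216RowResolvent (pieceMaj wrs_Rem₂_le)
open Literature.MathematicalPhysics.QuantumFieldTheory.Balaban1983to89.B13PerturbativeStep (wrs WRS WeightHyp)

noncomputable section

variable {Y : Type*} [Fintype Y] [DecidableEq Y] {Ω : Type*} [Fintype Ω] [DecidableEq Ω] {ν : ℕ}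

/-! ## §1 Cells of sites and piece domains read off the cell budgets -/

/-- The decoration CELL of a site: `gridCellOf M_d (e y)` (coordinatewise `⌊·/M_d⌋`). [folklore] -/
def cellAt (Md : ℕ) (e : Y → (Fin ν → ℤ)) (y : Y) : Fin ν → ℤ := gridCellOf Md (e y)

/-- The DOMAIN of a piece READ OFF its cell budget: the sites whose cell is charged to the piece. [folklore] -/
def domOf (Md : ℕ) (e : Y → (Fin ν → ℤ)) (cellsOf : Ω → Finset (Fin ν → ℤ)) (ω : Ω) : Finset Y :=
  Finset.univ.filter fun y => cellAt Md e y ∈ cellsOf ω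

omit [DecidableEq Y] [Fintype Ω] [DecidableEq Ω] in
/-- Membership in `domOf`. [folklore] -/
theorem mem_domOf (Md : ℕ) (e : Y → (Fin ν → ℤ)) (cellsOf : Ω → Finset (Fin ν → ℤ)) (ω : Ω) (y : Y) :
    y ∈ domOf Md e cellsOf ω ↔ cellAt Md e y ∈ cellsOf ω := by
  simp [domOf]

omit [DecidableEq Y] [Fintype Ω] [DecidableEq Ω] in
/-- **`hcells` holds by construction**: every site of `domOf ω` lies in a charged cell. [folklore] -/
theorem cellAt_mem_of_mem_domOf (Md : ℕ) (e : Y → (Fin ν → ℤ)) (cellsOf : Ω → Finset (Fin ν → ℤ)) :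
    ∀ ω, ∀ z ∈ domOf Md e cellsOf ω, cellAt Md e z ∈ cellsOf ω :=
  fun ω z hz => (mem_domOf Md e cellsOf ω z).1 hz

omit [DecidableEq Y] [Fintype Ω] [DecidableEq Ω] in
/-- **`hK` from row-locality in cells**: if `K_ω(k,l) ≠ 0 → cell(k) ∈ cellsOf ω` then `K_ω` is row-local on `domOf ω`.
[folklore] -/
theorem rowLocal_domOf (Md : ℕ) (e : Y → (Fin ν → ℤ)) (cellsOf : Ω → Finset (Fin ν → ℤ)) (K : Ω → Matrix Y Y ℂ)
    (hKcells : ∀ ω k l, K ω k l ≠ 0 → cellAt Md e k ∈ cellsOf ω) :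
    ∀ ω k l, K ω k l ≠ 0 → k ∈ domOf Md e cellsOf ω :=
  fun ω k l hk => (mem_domOf Md e cellsOf ω k).2 (hKcells ω k l hk)

/-! ## §2 The hand-off on the box -/

section Box

variable {q : ℕ}

/-- **THE Ω HAND-OFF ON A BOX OF `ℤ^ν`.**  Sites `e : Y → ℤ^ν` (any finite `Y`); partition `h_b = hPart M q e b`
(labels `b : Fin ν → Fin (q+1)`, cubes of side `M`, neighbourhoods `EPart`), cells of side `M_d ≥ 8M`, `d = supDistOn e`;
pieces `K_ω` with cell budgets `cellsOf ω`, row-local in their cells; near families with the far convention (threshold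
`m₀`); near-local inverses `L_b` with budget `C_L` at rate `κ′ = κ + κ₁2^ν/(2M)`; THE ONE BOUND `hT` at rate `κ⁺ > κ′`
with margin `κ₂ ≥ 0`; smallness `ρ_Ω < 1`.  THEN the fully decorated ω-family (`cellOf := cellAt M_d e`,
`D_ω := domOf`, credits `crCells (2M) (2^ν)`) with the coordinate `Δ₀` free is ROW DATA on `‖σ‖ < e^{κ₁}` at rate `κ`
— every geometric binder (`hsupp habs hLip hN hdiam hpack hcells hK hr hRD`) discharged BY NAME from
`UnitLatticePartition` ∕ `UnitLatticeTubeCount`. [cite: Balaban1988RG2Cluster, (1.11) p.5] -/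
theorem rowData_decFamilyΩ_box (hν : 0 < ν) {M Md : ℕ} (hM : 0 < M) (hMd : 8 * M ≤ Md) (e : Y → (Fin ν → ℤ))
    {κ κ₁ κ₂ κp ρ m₀ C_L : ℝ} (hκ : 0 ≤ κ) (hκ₁ : 0 ≤ κ₁) (hκ₂ : 0 ≤ κ₂) (hC : 0 ≤ C_L)
    (K : Ω → Matrix Y Y ℂ) (cellsOf : Ω → Finset (Fin ν → ℤ))
    (hKcells : ∀ ω k l, K ω k l ≠ 0 → cellAt Md e k ∈ cellsOf ω)
    (near : (Fin ν → Fin (q + 1)) → Finset Ω)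
    (hfar : ∀ b ω k l, ω ∉ near b → hPart M q e b l ≠ 0 → K ω k l ≠ 0 → m₀ ≤ (cellsOf ω).card)
    (L : (Fin ν → Fin (q + 1)) → Matrix Y Y ℂ)
    (hL : ∀ b, WRS (κ + κ₁ * ((2 ^ ν : ℕ) / (2 * (M : ℝ)))) (supDistOn e) (L b) C_L)
    (hκp : κ + κ₁ * ((2 ^ ν : ℕ) / (2 * (M : ℝ))) < κp)
    (hT : ∀ k, ∑ l, (∑ ω, pieceMaj (κ₁ + κ₂) K cellsOf ω k l) * Real.exp (κp * supDistOn e k l) ≤ ρ)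
    (hρ : C_L * (2 * (2 : ℝ) ^ ν / (2 * (M : ℝ) / (ν * π))
        * ((Real.exp 1 * (κp - (κ + κ₁ * ((2 ^ ν : ℕ) / (2 * (M : ℝ))))))⁻¹ * ρ)
        + (2 : ℝ) ^ ν * Real.exp (-(κ₂ * m₀)) * ρ) < 1)
    (τ : (Fin ν → ℤ) → ℂ) (hτ : ∀ δ, ‖τ δ‖ ≤ Real.exp κ₁) (Δ₀ : Fin ν → ℤ) :
    RowData κ (supDistOn e) (Real.exp κ₁)
      (decFamilyΩ (cellAt Md e) (EPart M q e) (domOf Md e cellsOf) (hPart M q e) K near L τ Δ₀)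
      (decMajΩ (Real.exp (κ₁ * (2 ^ ν : ℕ))) (κ₁ * ((2 ^ ν : ℕ) / (2 * (M : ℝ)))) (supDistOn e)
        (crCells (2 * (M : ℝ)) (2 ^ ν) cellsOf) (hPart M q e) K near L)
      (Real.exp (κ₁ * (2 ^ ν : ℕ)) * ((2 : ℝ) ^ ν * C_L) * (1 - (C_L * (2 * (2 : ℝ) ^ ν / (2 * (M : ℝ) / (ν * π))
        * ((Real.exp 1 * (κp - (κ + κ₁ * ((2 ^ ν : ℕ) / (2 * (M : ℝ))))))⁻¹ * ρ)
        + (2 : ℝ) ^ ν * Real.exp (-(κ₂ * m₀)) * ρ)))⁻¹) := by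
  have hM' : (0 : ℝ) < M := by exact_mod_cast hM
  have hν' : (0 : ℝ) < ν := by exact_mod_cast hν
  have hMeff : (0 : ℝ) < 2 * (M : ℝ) / (ν * π) := by positivity
  have hMd0 : 0 < Md := by omega
  have h2R : 2 * (4 * M) ≤ Md := by omega
  have hP : 0 < 2 ^ ν := pow_pos (by norm_num) ν
  exact rowData_decFamilyΩ_pieceMaj (weightHyp_supDistOn e hκ) K (domOf Md e cellsOf)
    (rowLocal_domOf Md e cellsOf K hKcells) near (hPart M q e) (EPart M q e) L
    (fun b y hy => hPart_supp hM q e b y hy) (fun b y => abs_hPart_le M q e b y) hMeff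
    (fun b y y' => hPart_lipschitz' hM hν q e b y y') (fun y => card_EPart_filter_le hM q e y) hC hκ₁
    (r := 2 * (M : ℝ)) (D := 2 * (M : ℝ)) (R := ((4 * M : ℕ) : ℝ)) (by positivity) (by push_cast; linarith)
    (cellAt Md e) hP (fun a => packing_comap hMd0 h2R e a) (fun b => diam_EPart_le q e b) cellsOf
    (cellAt_mem_of_mem_domOf Md e cellsOf) hfar hL hκp hκ₂ hT hρ τ hτ Δ₀

/-! ## §3 At `s ≡ 1` on the box: the sum is `(1 + Σ_ω K_ω)⁻¹` -/

/-- **THE IDENTIFICATION ON THE BOX.**  With the sites INSIDE the box (`0 ≤ e y ≤ qM` coordinatewise, so that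
`Σ_b h_b² = 1` — `UnitLatticePartition.hPart_sq_sum`), `κ₁ > 0`, the near-local inverse data `hPL`, `hloc` (the local
inverse for the NEAR kernel on `□̃_b`), and the hypotheses of `rowData_decFamilyΩ_box`: at `τ ≡ 1`, `σ = 1` the
decorated ω-family SUMS to `(1 + Ktot K)⁻¹` — the remainder smallness is the SAME number `ρ_Ω < 1`
(`AnalyticWalkSum216RowResolvent.wrs_Rem₂_le` + `UnitLatticeOmegaBudgets` BY NAME), so no separate input is left.
[cite: Balaban1988RG2Cluster, (1.11) p.5] -/
theorem termSum_decFamilyΩ_box_one (hν : 0 < ν) {M Md : ℕ} (hM : 0 < M) (hMd : 8 * M ≤ Md) (e : Y → (Fin ν → ℤ))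
    (hbox : ∀ y i, 0 ≤ e y i ∧ e y i ≤ q * M)
    {κ κ₁ κ₂ κp ρ m₀ C_L : ℝ} (hκ : 0 ≤ κ) (hκ₁ : 0 < κ₁) (hκ₂ : 0 ≤ κ₂) (hC : 0 ≤ C_L)
    (K : Ω → Matrix Y Y ℂ) (cellsOf : Ω → Finset (Fin ν → ℤ))
    (hKcells : ∀ ω k l, K ω k l ≠ 0 → cellAt Md e k ∈ cellsOf ω)
    (near : (Fin ν → Fin (q + 1)) → Finset Ω)
    (hfar : ∀ b ω k l, ω ∉ near b → hPart M q e b l ≠ 0 → K ω k l ≠ 0 → m₀ ≤ (cellsOf ω).card)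
    (L : (Fin ν → Fin (q + 1)) → Matrix Y Y ℂ) (hPL : ∀ b, Pj (EPart M q e) b * L b = L b)
    (hloc : ∀ b, Pj (EPart M q e) b * (1 + Knear K near b) * Pj (EPart M q e) b * L b = Pj (EPart M q e) b)
    (hL : ∀ b, WRS (κ + κ₁ * ((2 ^ ν : ℕ) / (2 * (M : ℝ)))) (supDistOn e) (L b) C_L)
    (hκp : κ + κ₁ * ((2 ^ ν : ℕ) / (2 * (M : ℝ))) < κp)
    (hT : ∀ k, ∑ l, (∑ ω, pieceMaj (κ₁ + κ₂) K cellsOf ω k l) * Real.exp (κp * supDistOn e k l) ≤ ρ)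
    (hρ : C_L * (2 * (2 : ℝ) ^ ν / (2 * (M : ℝ) / (ν * π))
        * ((Real.exp 1 * (κp - (κ + κ₁ * ((2 ^ ν : ℕ) / (2 * (M : ℝ))))))⁻¹ * ρ)
        + (2 : ℝ) ^ ν * Real.exp (-(κ₂ * m₀)) * ρ) < 1) (Δ₀ : Fin ν → ℤ) :
    termSum (decFamilyΩ (cellAt Md e) (EPart M q e) (domOf Md e cellsOf) (hPart M q e) K near L
      (fun _ => (1 : ℂ)) Δ₀) 1 = (1 + Ktot K)⁻¹ := by
  have hM' : (0 : ℝ) < M := by exact_mod_cast hM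
  have hν' : (0 : ℝ) < ν := by exact_mod_cast hν
  have hMeff : (0 : ℝ) < 2 * (M : ℝ) / (ν * π) := by positivity
  have hP : 0 < 2 ^ ν := pow_pos (by norm_num) ν
  have hw := weightHyp_supDistOn e hκ
  have hδ : 0 ≤ κ₁ * ((2 ^ ν : ℕ) / (2 * (M : ℝ))) := by positivity
  have hr : (2 * (M : ℝ)) ≠ 0 := by positivity
  have hcr : ∀ ω, κ₁ * ((2 ^ ν : ℕ) / (2 * (M : ℝ))) * crCells (2 * (M : ℝ)) (2 ^ ν) cellsOf ω
      ≤ κ₁ * ((cellsOf ω).card : ℝ) := fun ω => rate_crCells_le hr hP cellsOf ω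
  have hτ : ∀ δ : Fin ν → ℤ, ‖(fun _ => (1 : ℂ)) δ‖ ≤ Real.exp κ₁ := fun _ => by
    rw [norm_one]; exact Real.one_le_exp hκ₁.le
  have h1 : (1 : ℂ) ∈ ball (0 : ℂ) (Real.exp κ₁) := by
    rw [mem_ball_zero_iff, norm_one]; exact Real.one_lt_exp_iff.2 hκ₁
  -- the row data (§2) and the resummation identity with `Σ_b h_b² = 1` on the box
  have hRD := rowData_decFamilyΩ_box hν hM hMd e hκ hκ₁.le hκ₂ hC K cellsOf hKcells near hfar L hL hκp hT hρ
    (fun _ => (1 : ℂ)) hτ Δ₀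
  have hid := resummation_identity₂ K near (hPart M q e) (EPart M q e) L (hPart_sq_sum hM q e hbox)
    (fun b y hy => hPart_supp hM q e b y hy) hPL hloc
  -- the remainder smallness is the same number (budgets from the ONE bound)
  have hK1 := budgetK₁_of_pieceMaj (d := supDistOn e) hκp (le_add_of_nonneg_right hκ₂) K cellsOf
    (crCells (2 * (M : ℝ)) (2 ^ ν) cellsOf) hcr hT
  have hPhi := budgetΦ_of_pieceMaj hw.nonneg hκp.le hκ₂ K cellsOf (crCells (2 * (M : ℝ)) (2 ^ ν) cellsOf) hcr
    (hPart M q e) (EPart M q e) (fun b y hy => hPart_supp hM q e b y hy) (fun b y => abs_hPart_le M q e b y)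
    (fun y => card_EPart_filter_le hM q e y) near hfar hT
  have hRem := wrs_Rem₂_le hw hδ (crCells (2 * (M : ℝ)) (2 ^ ν) cellsOf)
    (fun ω => crCells_nonneg' (by positivity) (2 ^ ν) cellsOf ω) K near (hPart M q e) (EPart M q e) L
    (fun b y hy => hPart_supp hM q e b y hy) (fun b y => abs_hPart_le M q e b y) hMeff
    (fun b y y' => hPart_lipschitz' hM hν q e b y y') (fun y => card_EPart_filter_le hM q e y) hC hL hK1 hPhi
  exact termSum_decFamilyΩ_one hw hid hRem hρ (cellAt Md e) (EPart M q e) (domOf Md e cellsOf) Δ₀ hRD h1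

end Box

/-! ## §4 Non-vacuity -/

/-- **NON-VACUITY ON A BOX**: one site at the origin of `ℤ¹` (`q = 0`, `M = 1`, `M_d = 8`), zero pieces with empty cell
budgets, `near ≡ ∅`, `L ≡ 1`, `C_L = 1`, `κ = 0`, `κ₁ = 1`, `κ₂ = 0`, `κ⁺ = 2`, `ρ = 0`: the hypotheses of
`termSum_decFamilyΩ_box_one` are jointly satisfiable and the conclusion reads `termSum … 1 = (1 + 0)⁻¹`. [folklore] -/
example : termSum (decFamilyΩ (cellAt 8 (fun _ : Fin 1 => (0 : Fin 1 → ℤ))) (EPart 1 0 fun _ : Fin 1 => (0 : Fin 1 → ℤ))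
      (domOf 8 (fun _ : Fin 1 => (0 : Fin 1 → ℤ)) (fun _ : Fin 1 => (∅ : Finset (Fin 1 → ℤ))))
      (hPart 1 0 fun _ : Fin 1 => (0 : Fin 1 → ℤ)) (fun _ : Fin 1 => (0 : Matrix (Fin 1) (Fin 1) ℂ))
      (fun _ => (∅ : Finset (Fin 1))) (fun _ => (1 : Matrix (Fin 1) (Fin 1) ℂ)) (fun _ => (1 : ℂ)) 0) 1
    = (1 + Ktot (fun _ : Fin 1 => (0 : Matrix (Fin 1) (Fin 1) ℂ)))⁻¹ := by
  have hE : ∀ b : Fin 1 → Fin 1, EPart 1 0 (fun _ : Fin 1 => (0 : Fin 1 → ℤ)) b = Finset.univ := by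
    intro b
    ext y
    simp only [EPart, Finset.mem_filter, Finset.mem_univ, true_and, iff_true]
    simp [UnitLatticePartition.ctr, UnitLatticeTubeCount.supDist]
  have hPj : ∀ b : Fin 1 → Fin 1, Pj (EPart 1 0 fun _ : Fin 1 => (0 : Fin 1 → ℤ)) b = 1 := by
    intro b
    ext i j
    obtain rfl : i = j := Subsingleton.elim i j
    simp [Pj, hE b, Fin.fin_one_eq_zero i]
  refine termSum_decFamilyΩ_box_one (ν := 1) one_pos (M := 1) (Md := 8) one_pos (by norm_num)
    (fun _ : Fin 1 => (0 : Fin 1 → ℤ)) (fun y i => by simp) (κ := 0) (κ₁ := 1) (κ₂ := 0) (κp := 2) (ρ := 0)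
    (m₀ := 0) (C_L := 1) le_rfl one_pos le_rfl zero_le_one (fun _ : Fin 1 => (0 : Matrix (Fin 1) (Fin 1) ℂ))
    (fun _ => ∅) (fun ω k l hk => by simp at hk) (fun _ => ∅) (fun b ω k l _ _ hk => by simp at hk) (fun _ => 1)
    (fun b => by rw [hPj, Matrix.one_mul]) (fun b => ?_) (fun b => ?_) (by norm_num) (fun k => ?_) (by norm_num) 0
  · rw [hPj b, Knear, Finset.sum_empty, add_zero, Matrix.one_mul, Matrix.one_mul, Matrix.one_mul]
  · exact Literature.MathematicalPhysics.QuantumFieldTheory.Balaban1983to89.B13PerturbativeStep.WRS.one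
      (weightHyp_supDistOn (fun _ : Fin 1 => (0 : Fin 1 → ℤ)) (κ := 0 + 1 * ((2 ^ 1 : ℕ) / (2 * ((1 : ℕ) : ℝ))))
        (by norm_num))
  · simp [pieceMaj]

end

end Summit.QuantumFields.BalabanUV.Beta.UnitLatticeOmegaBox
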